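import Summits.AtomisticToContinuum.BoseEinsteinCondensation.Theorems.SoloBlindTwistGaussianDecay

/-!
# ℓ¹-stability of zero-freeness of twisted current sums (kernel K19)

Solo seat `solo-AtomisticToContinuum-blind`, conjunct `BoseEinsteinCondensation`; the (LF-1)/(T1)
step of `HOME/work/frustrated_fs/interpolation.md` §11–§12 (Lemma 13.20-A consumes zero-freeness of
the complex-twisted, tilted current law on a CLT-scale window; this file records that such
zero-freeness is STABLE under ℓ¹-perturbation of the tilted law, with the Villain/discrete-Gaussian
law of K12/K14/K15 as reference).

* `norm_tsum_mul_sub_le` : for weights `W, G : ℤ → ℂ` and multipliers `|u(n)| ≤ 1`,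
  `‖Σ W u − Σ G u‖ ≤ Σ |W − G|`; hence `‖Σ W u‖ ≥ ‖Σ G u‖ − Σ|W − G|` (`norm_tsum_mul_ge`) and
  `Σ|W − G| < ‖Σ G u‖ ⇒ Σ W u ≠ 0` (`tsum_mul_ne_zero_of_l1_lt`).
* `twistedSum_ne_zero_of_l1_close` : with the reference `G(n) = exp(−t(n−ν)²/2)` (the discrete
  Gaussian law of variance `1/t` tilted to centre `ν`; `Σ G(n)e^{inφ} = rotorWeight t ν φ`, K12),
  any `W` with `Σ|W − G| < ‖rotorWeight t ν φ‖` has `Σ W(n) e^{inφ} ≠ 0`;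
  `twistedSum_ne_zero_of_l1_lt_gaussian` makes the threshold explicit through K15:
  `Σ|W − G|·(1 − q) < √(2π/t)·e^{−φ²/(2t)}·(1 − 3q)`, `q = e^{−2πδ/t}`, `|φ| ≤ π − δ`, every `ν`.

Reading (dictionary `t = 1/β_b`, tilt `ψ = −tν`): on the CLT window `|φ| ≤ M√t` the admissible
ℓ¹-defect is a fixed fraction `e^{−M²/2}(1−3q)/(1−q)` of the reference mass `≈ √(2π/t)` — clause
(T1) of Lemma 13.20-A is ℓ¹-robust at relative precision O(1); near `φ = π` the admissible defect
is `e^{−π²/(2t)} = e^{−π²β/2}` of the mass — the fragility of a β-wide strip ('zeros in the tail',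
paper §13.10), quantified.  Nothing here bounds the window mass of the Bose gas; it is bookkeeping
for the typed class (i) input.
-/

noncomputable section

open Complex

namespace Summit.AtomisticToContinuum.BoseEinsteinCondensation.Theorems

/-! ### Abstract ℓ¹-stability -/

section Abstract

variable {W G u : ℤ → ℂ}

/-- If `W − G ∈ ℓ¹`, `|u| ≤ 1` and `Σ G u` converges then `Σ W u` converges. -/
theorem summable_mul_of_l1 (hWG : Summable fun n => ‖W n - G n‖) (hu : ∀ n, ‖u n‖ ≤ 1)
    (hG : Summable fun n => G n * u n) : Summable fun n => W n * u n := by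
  have hdiff : Summable fun n => (W n - G n) * u n :=
    Summable.of_norm_bounded hWG fun n => by
      rw [norm_mul]
      exact mul_le_of_le_one_right (norm_nonneg _) (hu n)
  have h : (fun n => W n * u n) = fun n => G n * u n + (W n - G n) * u n := by
    funext n; ring
  rw [h]
  exact hG.add hdiff

/-- **ℓ¹-stability**: `‖Σ W u − Σ G u‖ ≤ Σ |W − G|` for multipliers `|u| ≤ 1`. -/
theorem norm_tsum_mul_sub_le (hWG : Summable fun n => ‖W n - G n‖) (hu : ∀ n, ‖u n‖ ≤ 1)
    (hG : Summable fun n => G n * u n) :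
    ‖∑' n, W n * u n - ∑' n, G n * u n‖ ≤ ∑' n, ‖W n - G n‖ := by
  have hW := summable_mul_of_l1 hWG hu hG
  rw [← hW.tsum_sub hG]
  have hpt : ∀ n, ‖W n * u n - G n * u n‖ ≤ ‖W n - G n‖ := fun n => by
    rw [← sub_mul, norm_mul]
    exact mul_le_of_le_one_right (norm_nonneg _) (hu n)
  have hs : Summable fun n => ‖W n * u n - G n * u n‖ :=
    Summable.of_nonneg_of_le (fun n => norm_nonneg _) hpt hWG
  exact (norm_tsum_le_tsum_norm hs).trans (hs.tsum_le_tsum hpt hWG)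

/-- Hence `‖Σ G u‖ − Σ|W − G| ≤ ‖Σ W u‖`. -/
theorem norm_tsum_mul_ge (hWG : Summable fun n => ‖W n - G n‖) (hu : ∀ n, ‖u n‖ ≤ 1)
    (hG : Summable fun n => G n * u n) :
    ‖∑' n, G n * u n‖ - ∑' n, ‖W n - G n‖ ≤ ‖∑' n, W n * u n‖ := by
  have h := norm_tsum_mul_sub_le hWG hu hG
  have h2 : ‖∑' n, G n * u n‖ - ‖∑' n, W n * u n‖ ≤ ‖∑' n, W n * u n - ∑' n, G n * u n‖ := by
    rw [← norm_sub_rev]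
    exact norm_sub_norm_le _ _
  linarith

/-- **Zero-freeness is ℓ¹-open**: `Σ|W − G| < ‖Σ G u‖ ⇒ Σ W u ≠ 0`. -/
theorem tsum_mul_ne_zero_of_l1_lt (hWG : Summable fun n => ‖W n - G n‖) (hu : ∀ n, ‖u n‖ ≤ 1)
    (hG : Summable fun n => G n * u n) (hlt : ∑' n, ‖W n - G n‖ < ‖∑' n, G n * u n‖) :
    ∑' n, W n * u n ≠ 0 := by
  intro h0
  have h := norm_tsum_mul_ge hWG hu hG
  rw [h0, norm_zero] at h
  linarith

end Abstract

/-! ### Twisted sums against the discrete-Gaussian (Villain current) reference -/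

/-- The twist characters have modulus one. -/
theorem norm_cexp_twist (n : ℤ) (φ : ℝ) : ‖cexp (I * n * φ)‖ = 1 := by
  have h : I * (n : ℂ) * (φ : ℂ) = ((n * φ : ℝ) : ℂ) * I := by push_cast; ring
  rw [h, Complex.norm_exp_ofReal_mul_I]

/-- The reference: `G(n)·e^{inφ}` is the `n`-th term of `rotorWeight t ν φ` (K12). -/
theorem gaussRef_mul_twist (t ν φ : ℝ) (n : ℤ) :
    cexp (-(t * ((n : ℂ) - ν) ^ 2 / 2)) * cexp (I * n * φ) =
      cexp (I * n * φ - t * ((n : ℂ) - ν) ^ 2 / 2) := by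
  rw [← Complex.exp_add]
  congr 1
  ring

/-- `Σ_n G(n) e^{inφ} = rotorWeight t ν φ`. -/
theorem tsum_gaussRef_mul_twist (t ν φ : ℝ) :
    ∑' n : ℤ, cexp (-(t * ((n : ℂ) - ν) ^ 2 / 2)) * cexp (I * n * φ) = rotorWeight t ν φ := by
  unfold rotorWeight
  exact tsum_congr fun n => gaussRef_mul_twist t ν φ n

/-- The reference twisted series converges wherever `rotorWeight ≠ 0` (K14: `|φ| ≤ π − δ`,
`e^{−2πδ/t} < 1/3`, every `ν`). -/
theorem summable_gaussRef_mul_twist {t δ φ : ℝ} (ht : 0 < t) (hδ : 0 < δ) (hδπ : δ ≤ Real.pi)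
    (hφ : |φ| ≤ Real.pi - δ) (hq : Real.exp (-(2 * Real.pi * δ / t)) < 1 / 3) (ν : ℝ) :
    Summable fun n : ℤ => cexp (-(t * ((n : ℂ) - ν) ^ 2 / 2)) * cexp (I * n * φ) := by
  by_contra hns
  have hne := rotorWeight_ne_zero ht hδ hδπ hφ hq ν
  rw [← tsum_gaussRef_mul_twist, tsum_eq_zero_of_not_summable hns] at hne
  exact hne rfl

/-- **K19.** Any weight `W : ℤ → ℂ` that is ℓ¹-close to the tilted discrete Gaussian
`G(n) = e^{−t(n−ν)²/2}`, `Σ|W − G| < ‖rotorWeight t ν φ‖`, has non-vanishing twisted sum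
`Σ W(n)e^{inφ}` (for `|φ| ≤ π − δ`, `e^{−2πδ/t} < 1/3`, every centre `ν`), with
`‖Σ W(n)e^{inφ}‖ ≥ ‖rotorWeight t ν φ‖ − Σ|W − G|`. -/
theorem twistedSum_ne_zero_of_l1_close {t δ φ : ℝ} (ht : 0 < t) (hδ : 0 < δ) (hδπ : δ ≤ Real.pi)
    (hφ : |φ| ≤ Real.pi - δ) (hq : Real.exp (-(2 * Real.pi * δ / t)) < 1 / 3) (ν : ℝ)
    {W : ℤ → ℂ} (hW : Summable fun n : ℤ => ‖W n - cexp (-(t * ((n : ℂ) - ν) ^ 2 / 2))‖)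
    (hclose : ∑' n : ℤ, ‖W n - cexp (-(t * ((n : ℂ) - ν) ^ 2 / 2))‖ < ‖rotorWeight t ν φ‖) :
    ∑' n : ℤ, W n * cexp (I * n * φ) ≠ 0 ∧
      ‖rotorWeight t ν φ‖ - ∑' n : ℤ, ‖W n - cexp (-(t * ((n : ℂ) - ν) ^ 2 / 2))‖ ≤
        ‖∑' n : ℤ, W n * cexp (I * n * φ)‖ := by
  have hG := summable_gaussRef_mul_twist ht hδ hδπ hφ hq ν
  have hu : ∀ n : ℤ, ‖cexp (I * n * φ)‖ ≤ 1 := fun n => (norm_cexp_twist n φ).le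
  refine ⟨tsum_mul_ne_zero_of_l1_lt hW hu hG (by rwa [tsum_gaussRef_mul_twist]), ?_⟩
  have h := norm_tsum_mul_ge hW hu hG
  rwa [tsum_gaussRef_mul_twist] at h

/-- **K19, explicit threshold** (with K15's lower bound
`‖rotorWeight‖(1−q) ≥ √(2π/t)e^{−φ²/(2t)}(1−3q)`):
`Σ|W − G|·(1 − q) < √(2π/t)·e^{−φ²/(2t)}·(1 − 3q)`, `q = e^{−2πδ/t} < 1/3`, `|φ| ≤ π − δ`
⇒ `Σ W(n)e^{inφ} ≠ 0`, for every centre `ν`. -/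
theorem twistedSum_ne_zero_of_l1_lt_gaussian {t δ φ q : ℝ} (ht : 0 < t) (hδ : 0 < δ)
    (hδπ : δ ≤ Real.pi) (hφ : |φ| ≤ Real.pi - δ)
    (hqdef : q = Real.exp (-(2 * Real.pi * δ / t))) (hq3 : q < 1 / 3) (ν : ℝ) {W : ℤ → ℂ}
    (hW : Summable fun n : ℤ => ‖W n - cexp (-(t * ((n : ℂ) - ν) ^ 2 / 2))‖)
    (hclose : (∑' n : ℤ, ‖W n - cexp (-(t * ((n : ℂ) - ν) ^ 2 / 2))‖) * (1 - q) <
      Real.sqrt (2 * Real.pi / t) * Real.exp (-φ ^ 2 / (2 * t)) * (1 - 3 * q)) :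
    ∑' n : ℤ, W n * cexp (I * n * φ) ≠ 0 := by
  have hq1 : q < 1 := by linarith
  have hq' : Real.exp (-(2 * Real.pi * δ / t)) < 1 / 3 := hqdef ▸ hq3
  have hlow := villainTwisted_norm_lower ht hδ.le hδπ hφ hqdef hq1 ν
  rw [← rotorWeight_eq_villainTwisted t ν φ ht] at hlow
  have hlt : ∑' n : ℤ, ‖W n - cexp (-(t * ((n : ℂ) - ν) ^ 2 / 2))‖ < ‖rotorWeight t ν φ‖ := by
    have h1q : 0 < 1 - q := by linarith
    by_contra hge
    have hge' := mul_le_mul_of_nonneg_right (not_lt.mp hge) h1q.le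
    linarith
  exact (twistedSum_ne_zero_of_l1_close ht hδ hδπ hφ hq' ν hW hlt).1

/-- The CLT-window form of the threshold: for `|φ| ≤ M·√t` (and `|φ| ≤ π − δ`) it suffices that
`Σ|W − G|·(1 − q) < √(2π/t)·e^{−M²/2}·(1 − 3q)` — a FIXED fraction of the reference mass
`√(2π/t)`. -/
theorem twistedSum_ne_zero_on_clt_window {t δ φ q M : ℝ} (ht : 0 < t) (hδ : 0 < δ)
    (hδπ : δ ≤ Real.pi) (hφ : |φ| ≤ Real.pi - δ) (hM : |φ| ≤ M * Real.sqrt t)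
    (hqdef : q = Real.exp (-(2 * Real.pi * δ / t))) (hq3 : q < 1 / 3) (ν : ℝ) {W : ℤ → ℂ}
    (hW : Summable fun n : ℤ => ‖W n - cexp (-(t * ((n : ℂ) - ν) ^ 2 / 2))‖)
    (hclose : (∑' n : ℤ, ‖W n - cexp (-(t * ((n : ℂ) - ν) ^ 2 / 2))‖) * (1 - q) <
      Real.sqrt (2 * Real.pi / t) * Real.exp (-M ^ 2 / 2) * (1 - 3 * q)) :
    ∑' n : ℤ, W n * cexp (I * n * φ) ≠ 0 := by
  refine twistedSum_ne_zero_of_l1_lt_gaussian ht hδ hδπ hφ hqdef hq3 ν hW (hclose.trans_le ?_)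
  have h13 : 0 ≤ 1 - 3 * q := by linarith
  have hexp : Real.exp (-M ^ 2 / 2) ≤ Real.exp (-φ ^ 2 / (2 * t)) := by
    apply Real.exp_le_exp.2
    have hφ2 : φ ^ 2 ≤ M ^ 2 * t := by
      calc φ ^ 2 = |φ| ^ 2 := (sq_abs φ).symm
        _ ≤ (M * Real.sqrt t) ^ 2 := pow_le_pow_left₀ (abs_nonneg φ) hM 2
        _ = M ^ 2 * t := by rw [mul_pow, Real.sq_sqrt ht.le]
    have hdiv : φ ^ 2 / (2 * t) ≤ M ^ 2 / 2 := by
      rw [div_le_div_iff₀ (by positivity) (by norm_num)]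
      nlinarith
    have h1 : -M ^ 2 / 2 = -(M ^ 2 / 2) := by ring
    have h2 : -φ ^ 2 / (2 * t) = -(φ ^ 2 / (2 * t)) := by ring
    rw [h1, h2]
    exact neg_le_neg hdiv
  exact mul_le_mul_of_nonneg_right (mul_le_mul_of_nonneg_left hexp (Real.sqrt_nonneg _)) h13

end Summit.AtomisticToContinuum.BoseEinsteinCondensation.Theorems
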